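import Summits.NavierStokesRegularity.NavierStokesRegularity.Theses.PumpContinuation
import Summits.NavierStokesRegularity.NavierStokesRegularity.Theses.DssFarFieldSlaving
import Summits.NavierStokesRegularity.NavierStokesRegularity.Theorems.PumpContinuationEulerProximatePumpClassicalToMild
import Summits.NavierStokesRegularity.NavierStokesRegularity.Theorems.PumpContinuationEulerProximatePumpScalingTools
import Summits.NavierStokesRegularity.NavierStokesRegularity.Theorems.PumpContinuationEulerProximatePumpTransfer
import Summits.NavierStokesRegularity.NavierStokesRegularity.Theorems.PumpContinuationEulerProximatePumpDoorOfAccumulating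
import Summits.NavierStokesRegularity.NavierStokesRegularity.Theorems.PumpContinuationEulerProximatePumpAccumulatingOfDoor
import Summits.NavierStokesRegularity.NavierStokesRegularity.Theorems.PumpContinuationEulerProximatePumpTruncationBridgeTypeI
import Summits.NavierStokesRegularity.NavierStokesRegularity.Theorems.PumpContinuationEulerProximatePumpDoorOfDssProfile

/-!
# Route PumpContinuation · crux `EulerProximatePump` (stmt-NavierStokesRegularity-18302) — line `SketchIdeator2`

Skeleton of the TRANSFER line (card `zoom-sandwich`, positive line `door_of_dssChain`; = tier (i) of card
`conley-door`), INTEGRATED: six of the seven stubs are landed theorems of the tree (imported):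

* `stub_classicalTypeIToMild` (…ClassicalToMild) — classical maximal Type-I blow-up ⇒ Tao-mild Type-I blow-up of `B`
  with no mild extension;
* `stub_scalingTools` (…ScalingTools) — scaling covariance `u ↦ c u`, `T ↦ T'` with `T'(ca,cb,·) = c T(a,b,·)`;
* `stub_doorOfAccumulating`, `stub_accumulatingOfDoor` (…DoorOfAccumulating / …AccumulatingOfDoor) — the Door is
  EQUIVALENT to its amplitude-normalised form "`B + ηB̃_𝒜` blows up at a fixed ceiling for `η → 0⁺`";
* `stub_transfer` (…Transfer) — `BlowupTypeIDssProfile → DssTruncationBridgeTypeI → EulerProximatePump`;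
* `stub_dssTruncationBridgeTypeI` (…TruncationBridgeTypeI, lead c3) = item stmt-NavierStokesRegularity-14478 of route
  `DssFarFieldSlaving`, PROVED (`dssTruncationBridgeTypeI_proof`: the Type-I rate of the truncated RDSS solution is
  read off the trapped orbit of the period map — uniform slab bound + zoom concatenation, `cᵏ ≤ (1−t)^{−1/2}`).

The one-hypothesis conditional is itself a tree theorem: `eulerProximatePump_of_blowupTypeIDssProfile :
BlowupTypeIDssProfile → EulerProximatePump` (…DoorOfDssProfile, lead c3, with `nsTypeIMildBlowup_of_blowupTypeIDssProfile`).

What remains is EXACTLY ONE conjecture-grade item (not workable inside any line):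

* `stub_blowupTypeIDssProfile` = item stmt-NavierStokesRegularity-0155 = `¬`(Tsai's Type-I (rotated) λ-DSS Liouville
  conjecture) (open crux of routes Blowup / DssFarFieldSlaving).

Composition: `EulerProximatePump_of` (sorry-free given that item).
-/

noncomputable section

-- the nested summit namespace `…NavierStokesRegularity.NavierStokesRegularity…` is the tree's layout (D-0017)
set_option linter.dupNamespace false

open MeasureTheory Set Filter
open scoped ENNReal
open Literature.Analysis.FluidPDE Literature.Analysis.FluidPDE.Tao2016

namespace Summit.NavierStokesRegularity.NavierStokesRegularity.Theorems

namespace PumpContinuationEulerProximatePump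

/-! ## Open stub = item stmt-NavierStokesRegularity-0155 of routes `Blowup` / `DssFarFieldSlaving` -/

/-- **Stub = item stmt-NavierStokesRegularity-0155** (`DssFarFieldSlaving.BlowupTypeIDssProfile`, open crux of
route DssFarFieldSlaving, shared): failure of Tsai's Type-I (rotated) `λ`-DSS Liouville conjecture — a
nontrivial backward (rotated) discretely self-similar ancient mild solution with the Type-I bound. NOT worked
in this line: it is the other route's item, recorded here so that the composition is honest. [cite: Tsai2018, Conj. 8.8-8.9] -/
theorem stub_blowupTypeIDssProfile : Theses.DssFarFieldSlaving.BlowupTypeIDssProfile := by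
  sorry

-- stub_dssTruncationBridgeTypeI (= item stmt-NavierStokesRegularity-14478): LANDED in
-- Theorems/PumpContinuationEulerProximatePumpTruncationBridgeTypeI.lean (lead c3), imported above.

end PumpContinuationEulerProximatePump

/-! ## Compositions -/

open PumpContinuationEulerProximatePump

/-- **The transfer line**: DSS profile (stmt-0155, open) ⇒ the Door, by the landed one-hypothesis conditional
`eulerProximatePump_of_blowupTypeIDssProfile` (= `stub_transfer · stub_dssTruncationBridgeTypeI`: Type-I truncation bridge
stmt-14478, `stub_classicalTypeIToMild`, Euler-datum collapse of the segment). [folklore] -/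
theorem EulerProximatePump_of : Theses.PumpContinuation.EulerProximatePump :=
  eulerProximatePump_of_blowupTypeIDssProfile stub_blowupTypeIDssProfile

/-- **The Door in normal form**: `EulerProximatePump` is equivalent to "for some symmetric cancelling `𝒜` and
ceiling `M`, the forms `B + η B̃_𝒜` have Schwartz-data mild Type-I blow-ups at ceiling `M` with no mild
extension for `η` accumulating at `0⁺`" (landed stubs `stub_accumulatingOfDoor`, `stub_doorOfAccumulating`). [folklore] -/
theorem pumpContinuation_eulerProximatePump_iff_accumulating :
    Theses.PumpContinuation.EulerProximatePump ↔
    ∃ 𝒜 : AveragingDatum, 𝒜.IsSymmetric ∧ 𝒜.HasCancellation ∧ ∃ M : ℝ, ∀ η₀ : ℝ, 0 < η₀ →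
      ∃ η : ℝ, 0 < η ∧ η < η₀ ∧
        ∃ u₀ : SchwartzMap (EuclideanSpace ℝ (Fin 3)) (EuclideanSpace ℝ (Fin 3)),
          VectorCalculus.IsDivFree ⇑u₀ ∧ ∃ S : ℝ, 0 < S ∧ ∃ u : ℝ → L2C,
            IsMildSolutionFor (fun a b c => eulerForm a b c + ((η : ℝ) : ℂ) * 𝒜.form a b c)
              (schwartzL2 u₀) (Ico 0 S) u ∧
            (∀ t ∈ Ico 0 S, eLpNorm (u t) ⊤ volume ≤ ENNReal.ofReal (M / Real.sqrt (S - t))) ∧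
            ¬ ∃ S' : ℝ, S < S' ∧ ∃ v : ℝ → L2C,
                IsMildSolutionFor (fun a b c => eulerForm a b c + ((η : ℝ) : ℂ) * 𝒜.form a b c)
                  (schwartzL2 u₀) (Ico 0 S') v ∧ ∀ t ∈ Ico 0 S, v t = u t :=
  ⟨stub_accumulatingOfDoor, stub_doorOfAccumulating⟩

end Summit.NavierStokesRegularity.NavierStokesRegularity.Theorems

end
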